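import Summits.BirchSwinnertonDyer.Rank1Residual.X11b.ClassClosureSymbolTableModP
import Summits.BirchSwinnertonDyer.Rank1Residual.Iwasawa.UnitCoefficientFromRiemannSumModP
import Literature.NumberTheory.EllipticCurves.SkinnerUrban2014.PAdicUnitPeriodRatioProofs
import HarnessLib

/-!
# Class X11b = N8 (lane CLASS-CLOSURE, seat `cc-typer-3`): the symbol-table certificate with the
# PERIOD ingredient discharged — `‖Ω⁺_f/Ω_E‖_p = 1` from Mazur 1978 Cor. 4.1 (tree named fact
# `mazur_not_dvd_maninConstant_of_odd`) — so the per-pair datum is exactly: `hx`, one tabled level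
# `n₀` with `p^{n₀} > k`, ONE unit Riemann sum (cell `b2b-bsdres`)

HONEST FRAMING (verbatim, cell `b2b-bsdres`, run/shared/lean/b2b/bsd-rank1-residual/): the goal of
the cell is to DELETE the COMBINATION-SHAPED residual classes for ALL analytic-rank `≤ 1` curves
over `ℚ` — "full BSD formula for every rank `≤ 1` curve in class `C`" assembled STRICTLY from
published theorems — so that the rank-`≤ 1` remainder becomes exactly the CONSTRUCTION-SHAPED
classes, which are TYPED (missing-input Props), NOT attempted; this is not "finishing BSD".
Lane CLASS-CLOSURE: prove what is provable now; shrink each hard class to its core with data; no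
claim beyond stated classes. THEOREMS ONLY (no definition, no named fact, no `sorry`); nothing
booked; no label / mark changes; certificate rows are EVIDENCE / instrumentation.

## Why this file

census-ctyper-2's typer's check (HOME/b2b-bsdres-census-ctyper2/regmult/MUSPEC-TYPER-CHECK.md §8,
2026-08-21) reads the three kernel currencies of the unit-coefficient certificate on the 138 ¬(ram)
N8 cells — x-currency literal (`riemannSumUnitCertAt_of_symbolTable`, p290353), x-currency mod `p`
(`unitCoeffAt_of_symbolTable_modP`, p291705), f-currency mod `p` with the symbol bound discharged
(`Iwasawa.unitCoeffAt_of_lt_pow_of_analyticRank_ne_zero`, p292196) — and finds that, besides the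
identification `hx` and the finite certificate, exactly ONE period/integrality ingredient is consumed
per row: an all-levels bound on the ENGINE's table `x` (in print: Wuthrich 2014), or
`v_p(ϖ₀) ≥ 1 − n₀` for the period ratio `ϖ₀ = Ω⁺_{f₀}/Ω_E`, which is NOT printed in the instrument's
TSV. On X11b that ingredient is a consequence of ONE named fact ALREADY in the tree with consumers:
Mazur 1978, Cor. 4.1 (`mazur_not_dvd_maninConstant_of_odd`, lattice form) ⟹
`SkinnerUrban2014.exists_unit_mul_plusPeriod_of_irreducible_of_mazur` (`Ω_E = u·Ω⁺_f`, `‖u‖_p = 1`,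
at an ODD prime `p` with `p² ∤ N` — automatic at a multiplicative prime,
`not_sq_dvd_level_of_hasMultiplicativeReductionAtPrime` — and `E[p]` irreducible) ⟹ `‖ϖ₀‖_p = 1`.
With the tree's all-levels bound `‖[a/p^m]⁺_f‖_p ≤ 1` (odd multiplicative `p`, positive analytic
rank: `IsNewformOf.norm_ratPlusSymbol_val_div_le_one_of_multiplicative_of_analyticRank_ne_zero`,
cc-typer-6's p290987) this gives `‖x(a/p^m)‖_p ≤ 1` for the table `x = u·ϖ₀·[·]⁺_{f₀}` at ALL
levels, and the mod-`p` inequality `C·p⁻¹ < ‖RS k n₀‖` becomes `p⁻¹ < 1`. Hence: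

* `norm_ratCast_periodRatio_eq_one_of_eq_unit_mul`, `norm_ratCast_periodRatio_eq_one_of_mazur` —
  `‖ϖ₀‖_p = 1` (any newform of `W`, any level; odd multiplicative `p`, `E[p]` irreducible);
* `norm_symbolTable_le_norm_periodRatio` — `‖x(a/p^m)‖_p ≤ ‖ϖ₀‖_p` at all levels;
* `unitCoeffAt_of_symbolTable_of_norm_periodRatio_le_one` — x-currency road with the per-row check
  `‖ϖ₀‖_p ≤ 1` EXPLICIT (no `E[p]` hypothesis; any odd multiplicative `p`, `r_an ≠ 0`): datum =
  `hx` + `p^{n₀} > k` + `‖RS^x k n₀‖_p = 1`;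
* `unitCoeffAt_of_symbolTable_of_mazur`, `muAnZeroAt_of_symbolTable_of_mazur` — the same with the
  check discharged by Mazur's fact on `E[p]` irreducible;
* the f-currency twin of p292196 (`unitCoeffAt_of_lt_pow_of_mazur`) and the class-level minimal-pair
  roads (`bsdp_of_symbolTable_of_mazur_one`, `bsdp_of_ram_of_symbolTable_of_mazur_one`) are in the
  companion file `ClassClosureSymbolTablePeriodUnitRoads` (≤ 400 lines per Theorems file).

Nothing about any curve is asserted; nothing booked; X11b stays CONSTRUCTION-SHAPED; which rows
instantiate `hx` and the certificate is the census seats' EVIDENCE; the Mazur fact is a named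
binder like every other published input of the roads (no `_holds` in the tree; not discharged here).

References: [Mazur1978] Cor. 4.1; [GreenbergVatsal2000] §3 Rem. 3.4, p. 2–4; [EdixhovenManin1991]
Prop. 2; [AtkinLehner1970] Thm. 3–4; [MazurTateTeitelbaum1986Invent] §I.4 (4.2), §I.8, §I.10,
§I.12–I.14; [SteinWuthrich2013] §3, §4.2, Thm. 6.1; [Wuthrich2014] Thm. 1, Thm. 3; [CremonaAlgorithms1997]
Lemma 2.2.3; [Skinner2016PacificMC] Thm. A; [Disegni2020] Thm. 1; HOME/class-closure/O2/TYPER-3.md §15.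
-/

set_option autoImplicit false

noncomputable section

open scoped Classical MatrixGroups ModularForm

open CongruenceSubgroup WeierstrassCurve Literature.NumberTheory.EllipticCurves
  Literature.NumberTheory.EllipticCurves.ModularForms
  Literature.NumberTheory.EllipticCurves.Rank1Residual
  Literature.NumberTheory.EllipticCurves.Rank1Residual.Typed
  Literature.NumberTheory.EllipticCurves.Skinner2016
  Literature.NumberTheory.EllipticCurves.SteinWuthrich2013
  Literature.NumberTheory.EllipticCurves.Wuthrich2014
  Literature.NumberTheory.EllipticCurves.Disegni2020

namespace Summit.BirchSwinnertonDyer.Rank1Residual.X11b.ClassClosure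

open X11a

/-! ### §1 The period ratio `ϖ₀ = Ω⁺_{f₀}/Ω_E` is a `p`-adic unit (Mazur 1978, Cor. 4.1) -/

section PeriodRatio

variable (W : WeierstrassCurve ℚ) [W.IsElliptic] (p : ℕ) [Fact p.Prime]

/-- If `Ω(W) = u · Ω⁺_f` with `u ∈ ℚ`, `‖u‖_p = 1`, then every `ϖ ∈ ℚ` with `ϖ · Ω(W) = Ω⁺_f` has
`‖ϖ‖_p = 1`: `ϖ · u = 1` because `Ω(W) > 0` (`WeierstrassCurve.realPeriod_pos'`) forces `Ω⁺_f ≠ 0`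
(the norm form of `Rank1Residual.padicValRat_periodRatio_eq_zero_of_eq_unit_mul`).
[cite: GreenbergVatsal2000, §3, Remark 3.4] -/
theorem norm_ratCast_periodRatio_eq_one_of_eq_unit_mul {N : ℕ} [NeZero N] (f : CuspForm (Gamma0 N) 2)
    {u : ℚ} (hu : ‖(u : ℚ_[p])‖ = 1) (hΩ : W.realPeriodRat = u * plusPeriod f)
    (ϖ : ℚ) (hϖ : (ϖ : ℝ) * W.realPeriodRat = plusPeriod f) : ‖((ϖ : ℚ) : ℚ_[p])‖ = 1 := by
  have hΩpos : 0 < W.realPeriodRat := by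
    haveI : (W.baseChange ℝ).IsElliptic := by rw [baseChange]; infer_instance
    exact (W.baseChange ℝ).realPeriod_pos'
  have hplus : plusPeriod f ≠ 0 := by
    intro h0
    rw [h0, mul_zero] at hΩ
    exact hΩpos.ne' hΩ
  have hprod : ((ϖ * u : ℚ) : ℝ) = 1 := by
    have h1 : ((ϖ : ℝ) * u) * plusPeriod f = 1 * plusPeriod f := by
      rw [one_mul, mul_assoc, ← hΩ, hϖ]
    push_cast
    exact mul_right_cancel₀ hplus h1
  have hprodQ : ϖ * u = 1 := by exact_mod_cast hprod
  have hprodP : ((ϖ : ℚ) : ℚ_[p]) * ((u : ℚ) : ℚ_[p]) = 1 := by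
    rw [← Rat.cast_mul, hprodQ, Rat.cast_one]
  have hn := congrArg (‖·‖) hprodP
  simp only [norm_mul, hu, mul_one, norm_one] at hn
  exact hn

/-- **`‖Ω⁺_{f₀}/Ω_E‖_p = 1` at an ODD MULTIPLICATIVE prime `p` with `E[p]` irreducible, from Mazur
1978, Cor. 4.1** (tree named fact `mazur_not_dvd_maninConstant_of_odd`, via
`SkinnerUrban2014.exists_unit_mul_plusPeriod_of_irreducible_of_mazur`; `p² ∤ N` for the level of any
newform of `W` is `SkinnerUrban2014.not_sq_dvd_level_of_hasMultiplicativeReductionAtPrime`,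
Atkin–Lehner Thm. 3): for `W/ℚ` globally minimal elliptic, ANY newform `f₀` of `W` (any level) and
`ϖ₀ ∈ ℚ` with `ϖ₀ · Ω(W) = Ω⁺_{f₀}`. `p = 3` included. [cite: Mazur1978, Cor. 4.1]
[cite: GreenbergVatsal2000, §3, Remark 3.4] [cite: EdixhovenManin1991, Prop. 2] [cite: AtkinLehner1970, Thm. 3] -/
theorem norm_ratCast_periodRatio_eq_one_of_mazur [W.IsGloballyMinimal]
    (hM : mazur_not_dvd_maninConstant_of_odd) (hp2 : p ≠ 2)
    (hmult : W.HasMultiplicativeReductionAtPrime p) (hirr : W.HasIrreducibleModPGaloisRep p)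
    {N₀ : ℕ} [NeZero N₀] {f₀ : CuspForm (Gamma0 N₀) 2} (hf₀ : IsNewformOf W f₀)
    {ϖ₀ : ℚ} (hϖ₀ : (ϖ₀ : ℝ) * W.realPeriodRat = plusPeriod f₀) : ‖((ϖ₀ : ℚ) : ℚ_[p])‖ = 1 := by
  obtain ⟨u, hu, hΩ⟩ := SkinnerUrban2014.exists_unit_mul_plusPeriod_of_irreducible_of_mazur hM W p
    hp2 hirr f₀ hf₀ (SkinnerUrban2014.not_sq_dvd_level_of_hasMultiplicativeReductionAtPrime hmult hf₀)
  exact norm_ratCast_periodRatio_eq_one_of_eq_unit_mul W p f₀ hu hΩ ϖ₀ hϖ₀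

omit [W.IsElliptic] in
/-- **All-levels bound on the symbol table.** For a table `x = u·ϖ₀·[·]⁺_{f₀}` (`hx`) with
`‖u‖_p = 1`, at an odd multiplicative prime in positive analytic rank: `‖x(a/p^m)‖_p ≤ ‖ϖ₀‖_p` for
ALL `m, a` (the tree bound `‖[a/p^m]⁺_{f₀}‖_p ≤ 1`,
`IsNewformOf.norm_ratPlusSymbol_val_div_le_one_of_multiplicative_of_analyticRank_ne_zero`).
[cite: MazurTateTeitelbaum1986Invent, §I.4 (4.2), §I.8 and §I.10] [cite: CremonaAlgorithms1997, §2.2 Lemma 2.2.3] -/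
theorem norm_symbolTable_le_norm_periodRatio (hp2 : p ≠ 2)
    (hmult : W.HasMultiplicativeReductionAtPrime p) (hr : W.analyticRank ≠ 0)
    {N₀ : ℕ} [NeZero N₀] {f₀ : CuspForm (Gamma0 N₀) 2} (hf₀ : IsNewformOf W f₀) {ϖ₀ u : ℚ}
    (hu : ‖((u : ℚ) : ℚ_[p])‖ = 1) {x : ℚ → ℚ} (hx : ∀ r : ℚ, x r = u * ϖ₀ * ratPlusSymbol f₀ r)
    (m : ℕ) (a : ZMod (p ^ m)) :
    ‖(x ((a.val : ℚ) / (p : ℚ) ^ m) : ℚ_[p])‖ ≤ ‖((ϖ₀ : ℚ) : ℚ_[p])‖ := by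
  rw [hx, Rat.cast_mul, Rat.cast_mul, norm_mul, norm_mul, hu, one_mul]
  exact mul_le_of_le_one_right (norm_nonneg _)
    (hf₀.norm_ratPlusSymbol_val_div_le_one_of_multiplicative_of_analyticRank_ne_zero hp2 hmult hr m a)

end PeriodRatio

/-! ### §2 x-currency: `Iwasawa.UnitCoeffAt` from `hx` + (`p^{n₀} > k`, `‖RS^x k n₀‖_p = 1`) -/

section SymbolTable

variable (W : WeierstrassCurve ℚ) [W.IsElliptic] (p : ℕ) [Fact p.Prime]

/-- **x-currency road with the per-row period check EXPLICIT.** At an odd multiplicative prime in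
positive analytic rank: ONE newform `f₀` of `W`, its period ratio `ϖ₀` with `‖ϖ₀‖_p ≤ 1` (the
per-row check), a unit `u`, a table `x = u·ϖ₀·[·]⁺_{f₀}` (`hx`, the identification), and — for the
reduction sign's kind — ONE level `n₀` with `p^{n₀} > k` and the exact Riemann sums of `x` (signed
`(−1)^m` at a non-split `p`) with `‖RS k n₀‖_p = 1`, `k = n` non-split / `k = n + 1` split ⟹
`Iwasawa.UnitCoeffAt W p n` (for every newform / every `ϖ`, p277881). The all-levels bound and the
mod-`p` inequality of `unitCoeffAt_of_symbolTable_modP` are DISCHARGED (`C = 1`, `p⁻¹ < 1`). No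
`E[p]` hypothesis. Nothing booked. [cite: MazurTateTeitelbaum1986Invent, §I.10 Prop., §I.12–I.14]
[cite: SteinWuthrich2013, §3 and §4.2] [cite: AtkinLehner1970, Thm. 4] -/
theorem unitCoeffAt_of_symbolTable_of_norm_periodRatio_le_one (hp2 : p ≠ 2)
    (hmult : W.HasMultiplicativeReductionAtPrime p) (hr : W.analyticRank ≠ 0)
    {N₀ : ℕ} [NeZero N₀] {f₀ : CuspForm (Gamma0 N₀) 2}
    (hf₀ : IsNewformOf W f₀) {ϖ₀ : ℚ} (hϖ₀ : (ϖ₀ : ℝ) * W.realPeriodRat = plusPeriod f₀)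
    (hϖ₀' : ‖((ϖ₀ : ℚ) : ℚ_[p])‖ ≤ 1) {u : ℚ} (hu : ‖((u : ℚ) : ℚ_[p])‖ = 1) {x : ℚ → ℚ}
    (hx : ∀ r : ℚ, x r = u * ϖ₀ * ratPlusSymbol f₀ r) {n : ℕ}
    (hns : ¬ W.HasSplitMultiplicativeReductionAtPrime p →
        ∃ (n₀ : ℕ) (RS : ℕ → ℕ → ℚ_[p]),
          (∀ k m : ℕ, RS k m =
            ∑ᶠ ξ : rootsOfUnity (torsionOrder p) ℤ_[p], ∑ s : ZMod (p ^ m),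
              (fun (m : ℕ) (a : ZMod (p ^ m)) ↦
                  (-1 : ℚ_[p]) ^ m * (x ((a.val : ℚ) / (p : ℚ) ^ m) : ℚ_[p]))
                (m + cyclotomicExponent p)
                  (PadicInt.toZModPow (m + cyclotomicExponent p) ((ξ : ℤ_[p]ˣ) : ℤ_[p]) *
                    (cyclotomicGenerator p : ZMod (p ^ (m + cyclotomicExponent p))) ^ s.val) *
                ((s.val.choose k : ℕ) : ℚ_[p])) ∧
          n < p ^ n₀ ∧ ‖RS n n₀‖ = 1)
    (hs : W.HasSplitMultiplicativeReductionAtPrime p →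
        ∃ (n₀ : ℕ) (RS : ℕ → ℕ → ℚ_[p]),
          (∀ k m : ℕ, RS k m =
            ∑ᶠ ξ : rootsOfUnity (torsionOrder p) ℤ_[p], ∑ s : ZMod (p ^ m),
              (fun (m : ℕ) (a : ZMod (p ^ m)) ↦ (x ((a.val : ℚ) / (p : ℚ) ^ m) : ℚ_[p]))
                (m + cyclotomicExponent p)
                  (PadicInt.toZModPow (m + cyclotomicExponent p) ((ξ : ℤ_[p]ˣ) : ℤ_[p]) *
                    (cyclotomicGenerator p : ZMod (p ^ (m + cyclotomicExponent p))) ^ s.val) *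
                ((s.val.choose k : ℕ) : ℚ_[p])) ∧
          n + 1 < p ^ n₀ ∧ ‖RS (n + 1) n₀‖ = 1) :
    Iwasawa.UnitCoeffAt W p n := by
  have hC : ∀ (m : ℕ) (a : ZMod (p ^ m)), ‖(x ((a.val : ℚ) / (p : ℚ) ^ m) : ℚ_[p])‖ ≤ 1 :=
    fun m a ↦ (norm_symbolTable_le_norm_periodRatio W p hp2 hmult hr hf₀ hu hx m a).trans hϖ₀'
  have hlt1 : (1 : ℝ) * (p : ℝ)⁻¹ < 1 := by
    rw [one_mul]
    exact inv_lt_one_of_one_lt₀ (by exact_mod_cast (Fact.out : p.Prime).one_lt)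
  refine @unitCoeffAt_of_symbolTable_modP W _ p _ hmult N₀ _ f₀ hf₀ ϖ₀ hϖ₀ u hu x hx n ?_ ?_
  · intro h
    obtain ⟨n₀, RS, hRS, hk, hunit⟩ := hns h
    exact ⟨1, n₀, RS, hRS, hC, hk, by rw [hunit]; exact hlt1, hunit⟩
  · intro h
    obtain ⟨n₀, RS, hRS, hk, hunit⟩ := hs h
    exact ⟨1, n₀, RS, hRS, hC, hk, by rw [hunit]; exact hlt1, hunit⟩

/-- **x-currency road with the period check DISCHARGED by Mazur 1978, Cor. 4.1** (`E[p]`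
irreducible, odd multiplicative `p`, positive analytic rank; `W` globally minimal): datum = `hx` +
ONE level `n₀` with `p^{n₀} > k` + `‖RS^x k n₀‖_p = 1`. The named binder `hM` is the tree fact
`mazur_not_dvd_maninConstant_of_odd` (no `_holds`; not discharged here). Nothing booked.
[cite: Mazur1978, Cor. 4.1] [cite: GreenbergVatsal2000, §3, Remark 3.4]
[cite: MazurTateTeitelbaum1986Invent, §I.10 Prop., §I.12–I.14] [cite: SteinWuthrich2013, §3 and §4.2] -/
theorem unitCoeffAt_of_symbolTable_of_mazur [W.IsGloballyMinimal]
    (hM : mazur_not_dvd_maninConstant_of_odd) (hp2 : p ≠ 2)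
    (hmult : W.HasMultiplicativeReductionAtPrime p) (hirr : W.HasIrreducibleModPGaloisRep p)
    (hr : W.analyticRank ≠ 0) {N₀ : ℕ} [NeZero N₀] {f₀ : CuspForm (Gamma0 N₀) 2}
    (hf₀ : IsNewformOf W f₀) {ϖ₀ : ℚ} (hϖ₀ : (ϖ₀ : ℝ) * W.realPeriodRat = plusPeriod f₀)
    {u : ℚ} (hu : ‖((u : ℚ) : ℚ_[p])‖ = 1) {x : ℚ → ℚ}
    (hx : ∀ r : ℚ, x r = u * ϖ₀ * ratPlusSymbol f₀ r) {n : ℕ}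
    (hns : ¬ W.HasSplitMultiplicativeReductionAtPrime p →
        ∃ (n₀ : ℕ) (RS : ℕ → ℕ → ℚ_[p]),
          (∀ k m : ℕ, RS k m =
            ∑ᶠ ξ : rootsOfUnity (torsionOrder p) ℤ_[p], ∑ s : ZMod (p ^ m),
              (fun (m : ℕ) (a : ZMod (p ^ m)) ↦
                  (-1 : ℚ_[p]) ^ m * (x ((a.val : ℚ) / (p : ℚ) ^ m) : ℚ_[p]))
                (m + cyclotomicExponent p)
                  (PadicInt.toZModPow (m + cyclotomicExponent p) ((ξ : ℤ_[p]ˣ) : ℤ_[p]) *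
                    (cyclotomicGenerator p : ZMod (p ^ (m + cyclotomicExponent p))) ^ s.val) *
                ((s.val.choose k : ℕ) : ℚ_[p])) ∧
          n < p ^ n₀ ∧ ‖RS n n₀‖ = 1)
    (hs : W.HasSplitMultiplicativeReductionAtPrime p →
        ∃ (n₀ : ℕ) (RS : ℕ → ℕ → ℚ_[p]),
          (∀ k m : ℕ, RS k m =
            ∑ᶠ ξ : rootsOfUnity (torsionOrder p) ℤ_[p], ∑ s : ZMod (p ^ m),
              (fun (m : ℕ) (a : ZMod (p ^ m)) ↦ (x ((a.val : ℚ) / (p : ℚ) ^ m) : ℚ_[p]))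
                (m + cyclotomicExponent p)
                  (PadicInt.toZModPow (m + cyclotomicExponent p) ((ξ : ℤ_[p]ˣ) : ℤ_[p]) *
                    (cyclotomicGenerator p : ZMod (p ^ (m + cyclotomicExponent p))) ^ s.val) *
                ((s.val.choose k : ℕ) : ℚ_[p])) ∧
          n + 1 < p ^ n₀ ∧ ‖RS (n + 1) n₀‖ = 1) :
    Iwasawa.UnitCoeffAt W p n :=
  unitCoeffAt_of_symbolTable_of_norm_periodRatio_le_one W p hp2 hmult hr hf₀ hϖ₀
    (norm_ratCast_periodRatio_eq_one_of_mazur W p hM hp2 hmult hirr hf₀ hϖ₀).le hu hx hns hs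

/-- Hence x11a's `MuAnZeroAt W p` (the T-WK road's `μ`-input, p274916) from `hx` + ONE unit Riemann
sum at a tabled level with `p^{n₀} > k`, at ANY index, granted Mazur's fact.
[cite: GreenbergVatsal2000, p. 2–3, (1)–(2)] [cite: Mazur1978, Cor. 4.1] -/
theorem muAnZeroAt_of_symbolTable_of_mazur [W.IsGloballyMinimal]
    (hM : mazur_not_dvd_maninConstant_of_odd) (hp2 : p ≠ 2)
    (hmult : W.HasMultiplicativeReductionAtPrime p) (hirr : W.HasIrreducibleModPGaloisRep p)
    (hr : W.analyticRank ≠ 0) {N₀ : ℕ} [NeZero N₀] {f₀ : CuspForm (Gamma0 N₀) 2}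
    (hf₀ : IsNewformOf W f₀) {ϖ₀ : ℚ} (hϖ₀ : (ϖ₀ : ℝ) * W.realPeriodRat = plusPeriod f₀)
    {u : ℚ} (hu : ‖((u : ℚ) : ℚ_[p])‖ = 1) {x : ℚ → ℚ}
    (hx : ∀ r : ℚ, x r = u * ϖ₀ * ratPlusSymbol f₀ r) {n : ℕ}
    (hns : ¬ W.HasSplitMultiplicativeReductionAtPrime p →
        ∃ (n₀ : ℕ) (RS : ℕ → ℕ → ℚ_[p]),
          (∀ k m : ℕ, RS k m =
            ∑ᶠ ξ : rootsOfUnity (torsionOrder p) ℤ_[p], ∑ s : ZMod (p ^ m),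
              (fun (m : ℕ) (a : ZMod (p ^ m)) ↦
                  (-1 : ℚ_[p]) ^ m * (x ((a.val : ℚ) / (p : ℚ) ^ m) : ℚ_[p]))
                (m + cyclotomicExponent p)
                  (PadicInt.toZModPow (m + cyclotomicExponent p) ((ξ : ℤ_[p]ˣ) : ℤ_[p]) *
                    (cyclotomicGenerator p : ZMod (p ^ (m + cyclotomicExponent p))) ^ s.val) *
                ((s.val.choose k : ℕ) : ℚ_[p])) ∧
          n < p ^ n₀ ∧ ‖RS n n₀‖ = 1)
    (hs : W.HasSplitMultiplicativeReductionAtPrime p →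
        ∃ (n₀ : ℕ) (RS : ℕ → ℕ → ℚ_[p]),
          (∀ k m : ℕ, RS k m =
            ∑ᶠ ξ : rootsOfUnity (torsionOrder p) ℤ_[p], ∑ s : ZMod (p ^ m),
              (fun (m : ℕ) (a : ZMod (p ^ m)) ↦ (x ((a.val : ℚ) / (p : ℚ) ^ m) : ℚ_[p]))
                (m + cyclotomicExponent p)
                  (PadicInt.toZModPow (m + cyclotomicExponent p) ((ξ : ℤ_[p]ˣ) : ℤ_[p]) *
                    (cyclotomicGenerator p : ZMod (p ^ (m + cyclotomicExponent p))) ^ s.val) *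
                ((s.val.choose k : ℕ) : ℚ_[p])) ∧
          n + 1 < p ^ n₀ ∧ ‖RS (n + 1) n₀‖ = 1) :
    MuAnZeroAt W p :=
  Iwasawa.muAnZeroAt_of_unitCoeffAt
    (unitCoeffAt_of_symbolTable_of_mazur W p hM hp2 hmult hirr hr hf₀ hϖ₀ hu hx hns hs)

end SymbolTable

end Summit.BirchSwinnertonDyer.Rank1Residual.X11b.ClassClosure

end
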